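import Literature.AnabelianGeometry.EtaleTheta.SettingModelCurve
import Literature.GroupTheory.CombinatorialGroupTheory.FreeGroupCyclicKernelBasis
import HarnessLib

/-!
# The (Θ)-clause of [EtTh] Cor. 2.18 (i) at the Tate models, part 1: the DISCRETE Nielsen move on the Schreier
# basis of `Ker(Δ → ℤ/l)` (proof-only; K-L6 row «HTHETA-GEOM-NEG@modelTate», file 1 of 2)

S. Mochizuki, *The étale theta function and its Frobenioid-theoretic manifestations* [EtTh], Publ. RIMS **45**
(2009), Cor. 2.18 (i) p. 60 (the six invariance clauses for automorphisms of `Π^tp_{X̲̲}`, among them (Θ):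
`Ker(Π^tp_{X̲̲} ↠ (Π^tp_X)^Θ)` is preserved) [cite: MochizukiEtTh2009, Cor 2.18(i) p.60]; §1 p. 12 (`Δ_X` free
profinite on two generators, the class-two quotient `Δ^Θ_X`) [cite: MochizukiEtTh2009, §1 p.12]; Def. 2.5 (i) p. 39
(`X̲̲ → X`) [cite: MochizukiEtTh2009, Def 2.5 (i) p.39].  R. C. Lyndon, P. E. Schupp, *Combinatorial Group Theory*,
Ch. I Prop. 3.7 (Schreier's basis of a finite-index subgroup of a free group) [cite: LyndonSchupp2001, Ch. I Prop. 3.7].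
Cell `abc-iut`, K-L6 slice, row «HTHETA-GEOM-NEG@modelTate» (abc-iut-L6-lead gen 8, §F v1.19em (C) GO
2026-08-27T06:10Z), seat abc-iut-w5-d169 (gen 13).  PROOF-ONLY: no definition, no instance, no new named fact.

CONTEXT.  In the K-L6 display of [IUTchII] Cor. 1.12 (ii)(iii) at the stage-2 Tate model `modelχq p 1 2` the one
remaining F-0620 residual is the binder `hΘ := IsTopCharacteristic C.Huu (toTheta.ker.subgroupOf C.Huu)`
(abc-iut-w6-d028 p498716, abc-iut-L6-lead §F v1.19ee (A)): «`Ker(Π^tp_{X̲̲} ↠ (Π^tp_X)^Θ)` is stable under EVERY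
bi-continuous automorphism of `Π^tp_{X̲̲} = dUU l ⋊ G_{ℚ_p}`».  This two-file series proves the corresponding
NEGATIVE for the GEOMETRIC group alone: the `Γ`-part `⋂_N Ker(ĥ_N ∘ pr₁) ∩ dUU l` of that kernel is NOT characteristic
in the topological group `Δ^tp_{X̲̲} = dUU l` (file 2, `…ThetaKerGeomNotCharacteristicAtModelTate`).  So the (Θ)-clause,
if true at the model, is true BECAUSE of the arithmetic factor `G_{ℚ_p}` — the `_false_without_G_{ℚ_p}` species of
negative knowledge every later prover / refuter of `hΘ` must honour.

THIS FILE (the discrete core, over abc-iut-L2-t1's `Del = F₂`, `heisHom : F₂ → Heis ℤ` and the tree's Schreier basis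
`Literature.GroupTheory.CombinatorialGroupTheory.FreeGroupBasis.exists_freeGroupBasis_cyclicKernel`):
* `chi0_eq_heisHom_x` — the character `χ₀ : Δ → ℤ/l`, `a ↦ 1`, `b ↦ 0` (whose kernel is the discrete `Π^tp_{X̲} ∩ Δ`)
  is the `x`-coordinate of `heisHom` mod `l`; `heisHom_conj_pow`, `heisHom_pow_of_zero` — `a^n b a^{-n} ↦ (0,1,n)`,
  `a^n ↦ (n,0,0)`;
* **`exists_nielsen_cyclicKernel`** — on `U := Ker χ₀`, free on `{a^j b a^{-j}}_{j<l} ∪ {a^l}`, the elementary Nielsen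
  transformation `b ↦ b·C`, `C := (a b a⁻¹)(a^l (a b a⁻¹) a^{-l})⁻¹ = [a b a⁻¹, a^l]` (all other basis elements
  fixed) is an automorphism `Ψ₀` of `U` which (i) is the IDENTITY ON `U^{ab}` (`C` is a commutator), hence
  preserves every abelian invariant of `U` — the degree and the `z`-coordinate mod `l`; (ii) fixes `a^l`; (iii) sends
  `n₀ := b (a b a⁻¹)^{-2} (a² b a^{-2})`, an element with `heisHom n₀ = 1`, to an element with `heisHom = (0,0,−l)`.
File 2 transports `Ψ₀` to the closure `cl η(U) ≤ F̂₂` (its profinite completion) and to `dUU l ≤ F̂₂ ×_Ẑ ℤ`.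

HONEST LABEL.  Statements about the free group `F₂` and OUR semi-synthetic model of the [EtTh] §1 interface; nothing
of [EtTh] (refereed) or [IUTchII] (claim key `Mochizuki2012`, DISPUTED, D-0012) is asserted; no side is taken on
[IUTchIII] Cor. 3.12; typed ≠ proved; a negative about the geometric shadow is not a verdict on `hΘ`; nothing here
says abc is proved or refuted.
bears_on: LADDER-ABC:A2.L-K (K-L6 «HTHETA-GEOM-NEG@modelTate») → LADDER-FRONTIER F-A2 (M·L6) → rung 0 `Summit.ABC`.
-/

set_option autoImplicit false

noncomputable section

namespace Literature.AnabelianGeometry.EtaleTheta.SettingModel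

open Literature.GroupTheory.CombinatorialGroupTheory
open Multiplicative

/-! ## §1. The discrete Nielsen move on the Schreier basis of `Ker(F₂ → ℤ/l)` -/

/-- `χ₀ = (x-coordinate of heisHom) mod l`. [cite: MochizukiEtTh2009, §1 p.12] -/
theorem chi0_eq_heisHom_x (l : ℕ+) (χ₀ : F₂ →* Multiplicative (ZMod l))
    (hχ₀ : ∀ i, χ₀ (FreeGroup.of i) = if i = 0 then ofAdd (1 : ZMod l) else 1) (g : F₂) :
    χ₀ g = ofAdd (((heisHom g).x : ℤ) : ZMod l) := by
  let ψ : F₂ →* Multiplicative (ZMod l) :=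
    (AddMonoidHom.toMultiplicative (Int.castAddHom (ZMod l))).comp (Heis.xHom.comp heisHom)
  have hψ : ∀ g, ψ g = ofAdd (((heisHom g).x : ℤ) : ZMod l) := fun g => rfl
  rw [← hψ]
  refine DFunLike.congr_fun (FreeGroup.ext_hom _ _ fun i => ?_) g
  rw [hχ₀, hψ]
  fin_cases i
  · simp
  · simp

/-- `heisHom (a^n b a^{-n}) = (0, 1, n)`. [cite: MochizukiEtTh2009, §1 p.12] -/
theorem heisHom_conj_pow (n : ℕ) :
    heisHom (FreeGroup.of 0 ^ n * FreeGroup.of 1 * (FreeGroup.of 0 ^ n)⁻¹) = ⟨0, 1, (n : ℤ)⟩ := by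
  rw [map_mul, map_mul, map_inv, map_pow, heisHom_of_zero, heisHom_of_one, ← zpow_natCast,
    Heis.zpow_eq_of_mul_eq_zero _ (by simp)]
  ext <;> simp

/-- `heisHom (a^n) = (n, 0, 0)`. [cite: MochizukiEtTh2009, §1 p.12] -/
theorem heisHom_pow_of_zero (n : ℕ) : heisHom (FreeGroup.of 0 ^ n) = ⟨(n : ℤ), 0, 0⟩ := by
  rw [map_pow, heisHom_of_zero, ← zpow_natCast, Heis.zpow_eq_of_mul_eq_zero _ (by simp)]
  ext <;> simp

/-- **The discrete Nielsen move.** On `U = Ker(χ₀ : Δ → ℤ/l)` (`a ↦ 1`, `b ↦ 0`; the discrete `Π_{X̲} ∩ Δ`), free on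
the Schreier basis `{a^j b a^{-j}}_{j < l} ∪ {a^l}`, the elementary Nielsen transformation
`b ↦ b · (a b a⁻¹)(a^l (a b a⁻¹) a^{-l})⁻¹` (all other basis elements fixed) is an automorphism `Ψ₀` which
(i) is the identity on the abelianisation of `U` (hence preserves every abelian invariant: the degree `expA` and
the `z`-coordinate mod `l`), (ii) fixes `a^l`, and (iii) sends `n₀ := b (a b a⁻¹)^{-2} (a² b a^{-2})` — an element
with `heisHom n₀ = 1` — to an element with `heisHom = (0, 0, −l)`. [cite: LyndonSchupp2001, Ch. I Prop. 3.7] -/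
theorem exists_nielsen_cyclicKernel (l : ℕ+) (hl : 3 ≤ (l : ℕ)) (χ₀ : F₂ →* Multiplicative (ZMod l))
    (hχ₀ : ∀ i, χ₀ (FreeGroup.of i) = if i = 0 then ofAdd (1 : ZMod l) else 1) :
    ∃ Ψ₀ : (χ₀.comp Del.val).ker ≃* (χ₀.comp Del.val).ker,
      (∀ (M : Type) [CommGroup M] (φ : (χ₀.comp Del.val).ker →* M) (u : (χ₀.comp Del.val).ker), φ (Ψ₀ u) = φ u) ∧
      (∀ u : (χ₀.comp Del.val).ker, Del.val (u : Del) = FreeGroup.of 0 ^ (l : ℕ) → Ψ₀ u = u) ∧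
      ∃ n₀ : (χ₀.comp Del.val).ker, heisHom (Del.val (n₀ : Del)) = 1 ∧
        heisHom (Del.val (Ψ₀ n₀ : Del)) = ⟨0, 0, -((l : ℕ) : ℤ)⟩ := by
  classical
  haveI : NeZero (l : ℕ) := ⟨l.ne_zero⟩
  haveI : Fact (1 < (l : ℕ)) := ⟨by omega⟩
  -- the free basis of `Del` and the Schreier basis of the kernel
  let eD : Del ≃* F₂ := MulEquiv.ofBijective Del.val Del.val_bijective
  let bD : FreeGroupBasis (Fin 2) Del := FreeGroupBasis.ofRepr eD
  have hbD : ∀ i, Del.val (bD i) = FreeGroup.of i := fun i => by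
    change eD (eD.symm (FreeGroup.of i)) = FreeGroup.of i
    exact eD.apply_symm_apply _
  set χD : Del →* Multiplicative (ZMod l) := χ₀.comp Del.val with hχD
  have hχ : ∀ x, χD (bD x) = if x = 0 then ofAdd (1 : ZMod l) else 1 := fun x => by
    rw [hχD, MonoidHom.comp_apply, hbD, hχ₀]
  obtain ⟨bK, hbKl, hbKr⟩ := FreeGroupBasis.exists_freeGroupBasis_cyclicKernel bD (0 : Fin 2) l χD hχ
  -- the index set; the unique "other letter" `b`
  let β : {x : Fin 2 // x ≠ 0} := ⟨1, one_ne_zero⟩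
  have hβ : ∀ x : {x : Fin 2 // x ≠ 0}, x = β := fun x => by
    rcases x with ⟨x, hx⟩
    refine Subtype.ext ?_
    change x = 1
    fin_cases x
    · exact absurd rfl hx
    · rfl
  let I : Type := ({x : Fin 2 // x ≠ 0} × ZMod l) ⊕ Unit
  let g : ZMod l → FreeGroup I := fun a => FreeGroup.of (Sum.inl (β, a))
  let A : FreeGroup I := FreeGroup.of (Sum.inr ())
  let C₀ : FreeGroup I := g 1 * (A * g 1 * A⁻¹)⁻¹
  -- the Nielsen move and its inverse on the free group
  let f : FreeGroup I → FreeGroup I → (I → FreeGroup I) := fun c _ i =>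
    match i with
    | Sum.inl (x, a) => if a = 0 then FreeGroup.of (Sum.inl (x, a)) * c else FreeGroup.of (Sum.inl (x, a))
    | Sum.inr u => FreeGroup.of (Sum.inr u)
  let ΨF : FreeGroup I →* FreeGroup I := FreeGroup.lift (f C₀ 1)
  let ΨF' : FreeGroup I →* FreeGroup I := FreeGroup.lift (f C₀⁻¹ 1)
  have h10 : (1 : ZMod l) ≠ 0 := one_ne_zero
  have hΨF_g1 : ΨF (g 1) = g 1 := by
    change FreeGroup.lift (f C₀ 1) (FreeGroup.of (Sum.inl (β, 1))) = _
    rw [FreeGroup.lift_apply_of]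
    change (if (1 : ZMod l) = 0 then _ else _) = _
    rw [if_neg h10]
  have hΨF'_g1 : ΨF' (g 1) = g 1 := by
    change FreeGroup.lift (f C₀⁻¹ 1) (FreeGroup.of (Sum.inl (β, 1))) = _
    rw [FreeGroup.lift_apply_of]
    change (if (1 : ZMod l) = 0 then _ else _) = _
    rw [if_neg h10]
  have hΨF_A : ΨF A = A := FreeGroup.lift_apply_of
  have hΨF'_A : ΨF' A = A := FreeGroup.lift_apply_of
  have hΨF_C : ΨF C₀ = C₀ := by
    change ΨF (g 1 * (A * g 1 * A⁻¹)⁻¹) = _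
    rw [map_mul, map_inv, map_mul, map_mul, map_inv, hΨF_g1, hΨF_A]
  have hΨF'_C : ΨF' C₀ = C₀ := by
    change ΨF' (g 1 * (A * g 1 * A⁻¹)⁻¹) = _
    rw [map_mul, map_inv, map_mul, map_mul, map_inv, hΨF'_g1, hΨF'_A]
  have hΨF_of : ∀ (x : {x : Fin 2 // x ≠ 0}) (a : ZMod l), ΨF (FreeGroup.of (Sum.inl (x, a))) =
      if a = 0 then FreeGroup.of (Sum.inl (x, a)) * C₀ else FreeGroup.of (Sum.inl (x, a)) :=
    fun x a => FreeGroup.lift_apply_of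
  have hΨF'_of : ∀ (x : {x : Fin 2 // x ≠ 0}) (a : ZMod l), ΨF' (FreeGroup.of (Sum.inl (x, a))) =
      if a = 0 then FreeGroup.of (Sum.inl (x, a)) * C₀⁻¹ else FreeGroup.of (Sum.inl (x, a)) :=
    fun x a => FreeGroup.lift_apply_of
  have h1 : ΨF'.comp ΨF = MonoidHom.id _ := by
    refine FreeGroup.ext_hom _ _ fun i => ?_
    rw [MonoidHom.comp_apply, MonoidHom.id_apply]
    rcases i with ⟨x, a⟩ | u
    · rw [hΨF_of]
      by_cases ha : a = 0
      · rw [if_pos ha, map_mul, hΨF'_of, if_pos ha, hΨF'_C, mul_assoc, inv_mul_cancel, mul_one]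
      · rw [if_neg ha, hΨF'_of, if_neg ha]
    · rw [FreeGroup.lift_apply_of]
      exact FreeGroup.lift_apply_of
  have h2 : ΨF.comp ΨF' = MonoidHom.id _ := by
    refine FreeGroup.ext_hom _ _ fun i => ?_
    rw [MonoidHom.comp_apply, MonoidHom.id_apply]
    rcases i with ⟨x, a⟩ | u
    · rw [hΨF'_of]
      by_cases ha : a = 0
      · rw [if_pos ha, map_mul, hΨF_of, if_pos ha, map_inv, hΨF_C, mul_assoc, mul_inv_cancel, mul_one]
      · rw [if_neg ha, hΨF_of, if_neg ha]
    · rw [FreeGroup.lift_apply_of]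
      exact FreeGroup.lift_apply_of
  let ΨE : FreeGroup I ≃* FreeGroup I := MonoidHom.toMulEquiv ΨF ΨF' h1 h2
  let Ψ₀ : χD.ker ≃* χD.ker := bK.repr.trans (ΨE.trans bK.repr.symm)
  have hb : ∀ i, bK.repr.symm (FreeGroup.of i) = bK i := fun i => rfl
  have hΨ₀ : ∀ i, Ψ₀ (bK i) = bK.repr.symm (ΨF (FreeGroup.of i)) := fun i => by
    change bK.repr.symm (ΨF (bK.repr (bK i))) = _
    rw [FreeGroupBasis.repr_apply_coe]
  -- the "relator" `R = bK(β,1) · (bK ⋆ · bK(β,1) · bK ⋆⁻¹)⁻¹ = image of C₀`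
  set R : χD.ker := bK.repr.symm C₀ with hRdef
  have hR : R = bK (Sum.inl (β, 1)) * (bK (Sum.inr ()) * bK (Sum.inl (β, 1)) * (bK (Sum.inr ()))⁻¹)⁻¹ := by
    rw [hRdef]
    change bK.repr.symm (g 1 * (A * g 1 * A⁻¹)⁻¹) = _
    rw [map_mul, map_inv, map_mul, map_mul, map_inv, hb, hb]
  have hΨ₀_zero : ∀ x : {x : Fin 2 // x ≠ 0}, Ψ₀ (bK (Sum.inl (x, 0))) = bK (Sum.inl (x, 0)) * R := fun x => by
    rw [hΨ₀, hΨF_of, if_pos rfl, map_mul, hb]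
  have hΨ₀_ne : ∀ (x : {x : Fin 2 // x ≠ 0}) (a : ZMod l), a ≠ 0 →
      Ψ₀ (bK (Sum.inl (x, a))) = bK (Sum.inl (x, a)) := fun x a ha => by
    rw [hΨ₀, hΨF_of, if_neg ha, hb]
  have hΨ₀_inr : Ψ₀ (bK (Sum.inr ())) = bK (Sum.inr ()) := by
    rw [hΨ₀]
    change bK.repr.symm (ΨF A) = _
    rw [hΨF_A, hb]
  refine ⟨Ψ₀, fun M _ φ => ?_, fun u hu => ?_, ?_⟩
  · -- (i) identity on the abelianisation
    have hφR : φ R = 1 := by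
      rw [hR, map_mul, map_inv, map_mul, map_mul, map_inv, mul_inv_eq_one, mul_inv_cancel_comm]
    have key : φ.comp Ψ₀.toMonoidHom = φ := by
      refine bK.ext_hom _ _ fun i => ?_
      rw [MonoidHom.comp_apply, MulEquiv.coe_toMonoidHom]
      rcases i with ⟨x, a⟩ | ⟨⟩
      · by_cases ha : a = 0
        · subst ha
          rw [hΨ₀_zero, map_mul, hφR, mul_one]
        · rw [hΨ₀_ne x a ha]
      · rw [hΨ₀_inr]
    intro u
    exact DFunLike.congr_fun key u
  · -- (ii) fixes `a^l`
    have hu' : u = bK (Sum.inr ()) := by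
      apply Subtype.ext
      apply Del.val_bijective.1
      rw [hu, hbKr, map_pow, hbD]
    rw [hu', hΨ₀_inr]
  · -- (iii) the witness
    have hval : ∀ k : ℕ, k < 3 → ((k : ZMod l)).val = k := fun k hk => by
      rw [ZMod.val_natCast, Nat.mod_eq_of_lt (by omega)]
    have hvK : ∀ k : ℕ, k < 3 → Del.val ((bK (Sum.inl (β, (k : ZMod l))) : Del)) =
        FreeGroup.of 0 ^ k * FreeGroup.of 1 * (FreeGroup.of 0 ^ k)⁻¹ := fun k hk => by
      rw [hbKl, map_mul, map_mul, map_inv, map_pow, hbD, hbD, hval k hk]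
    have hvA : Del.val ((bK (Sum.inr ())) : Del) = FreeGroup.of 0 ^ (l : ℕ) := by
      rw [hbKr, map_pow, hbD]
    have hK0 : ∀ k : ℕ, k < 3 → heisHom (Del.val ((bK (Sum.inl (β, (k : ZMod l))) : Del))) = ⟨0, 1, (k : ℤ)⟩ :=
      fun k hk => by rw [hvK k hk, heisHom_conj_pow]
    have hKA : heisHom (Del.val ((bK (Sum.inr ())) : Del)) = ⟨((l : ℕ) : ℤ), 0, 0⟩ := by
      rw [hvA, heisHom_pow_of_zero]
    let n₀ : χD.ker := bK (Sum.inl (β, ((0 : ℕ) : ZMod l))) * (bK (Sum.inl (β, ((1 : ℕ) : ZMod l))) ^ 2)⁻¹ *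
      bK (Sum.inl (β, ((2 : ℕ) : ZMod l)))
    have hH : ∀ u v : χD.ker, heisHom (Del.val ((u * v : χD.ker) : Del)) =
        heisHom (Del.val (u : Del)) * heisHom (Del.val (v : Del)) := fun u v => by
      rw [Subgroup.coe_mul, map_mul, map_mul]
    have hHi : ∀ u : χD.ker, heisHom (Del.val ((u⁻¹ : χD.ker) : Del)) = (heisHom (Del.val (u : Del)))⁻¹ :=
      fun u => by rw [Subgroup.coe_inv, map_inv, map_inv]
    have hHp : ∀ (u : χD.ker) (k : ℕ), heisHom (Del.val ((u ^ k : χD.ker) : Del)) =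
        (heisHom (Del.val (u : Del))) ^ k := fun u k => by rw [Subgroup.coe_pow, map_pow, map_pow]
    refine ⟨n₀, ?_, ?_⟩
    · change heisHom (Del.val ((bK (Sum.inl (β, ((0 : ℕ) : ZMod l))) *
        (bK (Sum.inl (β, ((1 : ℕ) : ZMod l))) ^ 2)⁻¹ * bK (Sum.inl (β, ((2 : ℕ) : ZMod l))) : χD.ker) : Del)) = 1
      rw [hH, hH, hHi, hHp, hK0 0 (by omega), hK0 1 (by omega), hK0 2 (by omega), pow_two]
      ext <;> simp
    · have h00 : ((0 : ℕ) : ZMod l) = 0 := Nat.cast_zero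
      have h1ne : ((1 : ℕ) : ZMod l) ≠ 0 := by rw [Nat.cast_one]; exact h10
      have h2ne : ((2 : ℕ) : ZMod l) ≠ 0 := by
        intro h
        have := congrArg ZMod.val h
        rw [hval 2 (by omega), ZMod.val_zero] at this
        omega
      change heisHom (Del.val ((Ψ₀ (bK (Sum.inl (β, ((0 : ℕ) : ZMod l))) *
        (bK (Sum.inl (β, ((1 : ℕ) : ZMod l))) ^ 2)⁻¹ * bK (Sum.inl (β, ((2 : ℕ) : ZMod l)))) : χD.ker) : Del)) = _
      rw [map_mul, map_mul, map_inv, map_pow, hΨ₀_ne β _ h1ne, hΨ₀_ne β _ h2ne]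
      have hz : Ψ₀ (bK (Sum.inl (β, ((0 : ℕ) : ZMod l)))) = bK (Sum.inl (β, ((0 : ℕ) : ZMod l))) * R := by
        have := hΨ₀_zero β
        rw [← h00] at this
        exact this
      have h1' : heisHom (Del.val ((bK (Sum.inl (β, (1 : ZMod l)))) : Del)) = ⟨0, 1, 1⟩ := by
        have := hK0 1 (by omega)
        rw [Nat.cast_one] at this
        rw [this]; rfl
      rw [hz, hR]
      simp only [Subgroup.coe_mul, Subgroup.coe_inv, Subgroup.coe_pow, map_mul, map_inv, map_pow]
      rw [hK0 0 (by omega), hK0 2 (by omega), Nat.cast_one, h1', hKA, pow_two]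
      ext <;> simp

end Literature.AnabelianGeometry.EtaleTheta.SettingModel

end
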